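import Literature.AlgebraicGeometry.Resolution.GenericFormMissesFibreComponents
import Mathlib.RingTheory.Polynomial.Basic
import HarnessLib

/-!
# [OURS · L1 W4.5(b) · EL♮(3)] (δ) D1 ↔ D5 — the two spellings of an EXCLUDED COORDINATE POINT on a chart over a DVR
# (crux `EquisingularLiftNatThree` stmt-ResolutionOfSingularities-20148 / parent 20038; rung v7′ TC⁺⁺, STEP 0 per subset)

NOT a statement of any manuscript. Helper file of the chain res-L1-w45b (cell `res-hironaka`, LADDER-RESOLUTION rung L, slot W4.5(b));
OURS; AI-written, weaker than expert review; `--supports stmt-ResolutionOfSingularities-20148 --as helper` by res-L1-w45b-stub-3. No `sorry`;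
standard axioms; no definitions. Ring-level only.

WHAT. (δ) D1 `exists_clusterConeLift_subset` (p548257) excludes, on the chart `j`, the primes `Q ∋ C ϖ` of `O[T]/(Φ_j)` lying over a
cluster point by `(Ideal.span (Set.range fun l => X l − C (β l))).comap (MvPolynomial.map π) ≠ Q.comap mk` (`β` the `k`-coordinates,
`π : O ↠ k`, `ker π = (ϖ)`); res-type-100's (δ) D5 engine `isRegularLocalRing_quotient_carrierDelta_of_goodChart` (…NatCarrierDeltaOffCluster)
asks instead `¬ ∀ l, mk (X l − C (b l)) ∈ Q` for LIFTS `b` of `β`. The two agree at every prime containing `C ϖ`: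
* `comap_map_span_X_sub_C` — `(map π)⁻¹ (T_l − β_l : l) = (T_l − b_l : l) + (C ϖ)`;
* `eq_span_X_sub_C_sup_iff_forall_mem` — for a prime `Q̃ ∋ C ϖ` of `O[T]` (`O` local, `(ϖ) = 𝔪_O`): `Q̃ = (T_l − b_l : l) + (C ϖ) ↔ ∀ l,
  T_l − b_l ∈ Q̃` (Taylor expansion `f ≡ f(b) mod (T − b)` and `f(b) ∈ O = 𝔪_O ⊔ Oˣ`);
* **`comap_ne_comap_mk_iff_not_forall_mem`** — D1's spelling ↔ D5's spelling.

References: res-L1-w45b-stub-3 p548257 ((δ) D1); res-type-100 …NatCarrierDeltaOffCluster ((δ) D5); typed port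
`Literature.AlgebraicGeometry.Resolution.GenericFormMissesFibreComponents` (`sub_C_eval_mem_span`) [folklore].
-/

set_option linter.dupNamespace false -- mandated namespace `Summit.<Summit>.<Problem>` of this single-conjunct summit

noncomputable section

namespace Summit.ResolutionOfSingularities.ResolutionOfSingularities.Cruxes.EquisingularLiftNat.Sections.TCPlus

open MvPolynomial IsLocalRing Literature.AlgebraicGeometry.Resolution

variable {O : Type*} [CommRing O] {k : Type*} [CommRing k] {σ : Type*} (π : O →+* k) (ϖ : O)

/-- **The preimage of a coordinate point ideal under reduction mod `ϖ`**: for `π : O ↠ k` with `ker π = (ϖ)` and lifts `b` of the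
coordinates, `(map π)⁻¹ (T_l − π b_l : l) = (T_l − b_l : l) + (C ϖ)`. [folklore] -/
theorem comap_map_span_X_sub_C (hπ : Function.Surjective π) (hker : RingHom.ker π = Ideal.span {ϖ}) (b : σ → O) :
    (Ideal.span (Set.range fun l => (X l : MvPolynomial σ k) - C (π (b l)))).comap (MvPolynomial.map π) =
      Ideal.span (Set.range fun l => (X l : MvPolynomial σ O) - C (b l)) ⊔ Ideal.span {C ϖ} := by
  have hfun : (⇑(MvPolynomial.map π) ∘ fun l => (X l : MvPolynomial σ O) - C (b l)) =
      fun l => (X l : MvPolynomial σ k) - C (π (b l)) := by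
    funext l
    simp
  have hmap : (Ideal.span (Set.range fun l => (X l : MvPolynomial σ O) - C (b l))).map (MvPolynomial.map π) =
      Ideal.span (Set.range fun l => (X l : MvPolynomial σ k) - C (π (b l))) := by
    rw [Ideal.map_span, ← Set.range_comp, hfun]
  rw [← hmap, Ideal.comap_map_of_surjective _ (MvPolynomial.map_surjective π hπ), ← RingHom.ker_eq_comap_bot,
    MvPolynomial.ker_map, hker, Ideal.map_span, Set.image_singleton]

/-- **A prime of `O[T]` containing `C ϖ` is the lifted point ideal iff it contains the lifted coordinates** (`O` local with
`𝔪_O = (ϖ)`): `Q̃ = (T_l − b_l : l) + (C ϖ) ↔ ∀ l, T_l − b_l ∈ Q̃`. [folklore] -/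
theorem eq_span_X_sub_C_sup_iff_forall_mem [IsLocalRing O] (hϖ : maximalIdeal O = Ideal.span {ϖ}) (b : σ → O)
    (Q : Ideal (MvPolynomial σ O)) [Q.IsPrime] (hϖQ : (C ϖ : MvPolynomial σ O) ∈ Q) :
    Q = Ideal.span (Set.range fun l => (X l : MvPolynomial σ O) - C (b l)) ⊔ Ideal.span {C ϖ} ↔
      ∀ l, (X l : MvPolynomial σ O) - C (b l) ∈ Q := by
  constructor
  · intro hQ l
    rw [hQ]
    exact Ideal.mem_sup_left (Ideal.subset_span (Set.mem_range_self l))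
  · intro hX
    refine le_antisymm (fun f hf => ?_)
      (sup_le (Ideal.span_le.2 (Set.range_subset_iff.2 fun l => hX l)) ((Ideal.span_singleton_le_iff_mem _).2 hϖQ))
    -- Taylor: `f = (f − f(b)) + f(b)` with `f − f(b) ∈ (T − b)`; and `f(b) ∈ 𝔪_O = (ϖ)` (else `f(b)` is a unit in `Q`)
    have hT := sub_C_eval_mem_span b f
    have hev : C (MvPolynomial.eval b f) ∈ Q := by
      have h := Q.sub_mem hf ((Ideal.span_le.2 (Set.range_subset_iff.2 fun l => hX l)) hT)
      rwa [sub_sub_cancel] at h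
    have hev𝔪 : MvPolynomial.eval b f ∈ maximalIdeal O := by
      by_contra hunit
      rw [IsLocalRing.mem_maximalIdeal, mem_nonunits_iff, not_not] at hunit
      exact (Ideal.IsPrime.ne_top ‹_›) (Ideal.eq_top_of_isUnit_mem _ hev (hunit.map C))
    rw [hϖ, Ideal.mem_span_singleton] at hev𝔪
    obtain ⟨r, hr⟩ := hev𝔪
    have hC : C (MvPolynomial.eval b f) ∈ Ideal.span {(C ϖ : MvPolynomial σ O)} := by
      rw [hr, map_mul]
      exact Ideal.mul_mem_right _ _ (Ideal.mem_span_singleton_self _)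
    have hsum : f = (f - C (MvPolynomial.eval b f)) + C (MvPolynomial.eval b f) := by ring
    rw [hsum]
    exact Ideal.add_mem _ (Ideal.mem_sup_left hT) (Ideal.mem_sup_right hC)

/-- **(δ) D1's exclusion ↔ (δ) D5's exclusion.** Over a local `O` with `𝔪_O = (ϖ)`, `π : O ↠ k` with `ker π = (ϖ)`, `β` the
`k`-coordinates of a point and `b` lifts (`π b_l = β_l`): for a prime `Q` of `O[T]/J` containing `C ϖ`,
`(map π)⁻¹ (T_l − β_l : l) ≠ Q.comap mk ↔ ¬ ∀ l, mk (T_l − b_l) ∈ Q`. [folklore] [OURS · L1 W4.5b] -/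
theorem comap_ne_comap_mk_iff_not_forall_mem [IsLocalRing O] (hϖ : maximalIdeal O = Ideal.span {ϖ})
    (hπ : Function.Surjective π) (hker : RingHom.ker π = Ideal.span {ϖ}) (β : σ → k) (b : σ → O) (hb : ∀ l, π (b l) = β l)
    (J : Ideal (MvPolynomial σ O)) (Q : Ideal (MvPolynomial σ O ⧸ J)) [Q.IsPrime]
    (hϖQ : Ideal.Quotient.mk J (C ϖ : MvPolynomial σ O) ∈ Q) :
    (Ideal.span (Set.range fun l => (X l : MvPolynomial σ k) - C (β l))).comap (MvPolynomial.map π) ≠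
        Q.comap (Ideal.Quotient.mk J) ↔
      ¬ ∀ l, Ideal.Quotient.mk J ((X l : MvPolynomial σ O) - C (b l)) ∈ Q := by
  have hβ : (fun l => (X l : MvPolynomial σ k) - C (β l)) = fun l => (X l : MvPolynomial σ k) - C (π (b l)) := by
    funext l
    rw [hb]
  haveI : (Q.comap (Ideal.Quotient.mk J)).IsPrime := Ideal.comap_isPrime _ _
  rw [hβ, comap_map_span_X_sub_C π ϖ hπ hker b, ne_comm, Ne,
    eq_span_X_sub_C_sup_iff_forall_mem ϖ hϖ b (Q.comap (Ideal.Quotient.mk J)) (Ideal.mem_comap.2 hϖQ)]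
  simp only [Ideal.mem_comap]

end Summit.ResolutionOfSingularities.ResolutionOfSingularities.Cruxes.EquisingularLiftNat.Sections.TCPlus

end
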